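import Literature.NumberTheory.EllipticCurves.HeegnerEnvelopeReverseProofs
import Literature.NumberTheory.EllipticCurves.Castella2024.LambdaAdicHeegnerClassExistence
import Literature.NumberTheory.EllipticCurves.TwoVariableAnticyclotomicControl
import HarnessLib

/-!
# Norm operators `𝒩_{k+n→k} = Σ_{i<pⁿ} conj_{γ^{p^k i}}` on the compact Selmer levels `∏_m H¹(K_ℓ, E[p^m])`
# of a `ℤ_p`-extension: operator algebra, the iterated norm compatibility of `𝔖_p(K_∞)`, injectivity of
# restriction under `E(K)[p] = 0`, and norms of Kummer families (proofs file)

Topic `NumberTheory/EllipticCurves`. THEOREMS ONLY (no definition, no named fact, no `sorry`). Written by the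
cell `bsd-print-x9` seat `bsd-line-x9-p2` as the operator half of the UNIVERSAL-NORM argument for the
Heegner-module envelope `ℋ_∞(F) ⊆ Λκ_∞(C)` (crux stmt-BirchSwinnertonDyer-26359, stub `stub_envelopeTied`):
an element of `𝔖_p(K_∞) = lim←_ℓ S_p(E/K_ℓ)` is, at every layer `k`, a universal norm
(`res_{K_k→K_{k+n}} x_k = 𝒩_{k+n→k} x_{k+n}`, the iterate of the tree's one-step `proj_norm`), restriction
`S_p(E/K_k) → S_p(E/K_{k+n})` is INJECTIVE when `E(K)[p] = 0` (inflation–restriction + `E(K_∞)[p^∞] = 0`),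
and norms of Kummer families of points already rational over `K_k` are `pⁿ`-multiples.

WHAT (all for `V = W/K`, `κ` a `ℤ_p`-extension, `γ` a topological generator where needed).
* §1 operator algebra on `∏_m H¹(H, E[p^m])`: `padicPi_add_left` (`(a+b)·y = a·y + b·y`), `padicPi_sub_left`,
  `resPi_padicPi`, `resPi_conjPi`, `resPi_resPi`, `conjPi_eq_self_of_mem` (`σ ∈ H`), `conjPi_pow_eq_conjPi_pow_mod`
  (`conj_{γ^i} = conj_{γ^{i mod p^k}}` on level `k`).
* §2 the norm sums: `sum_conjPi_padicPi`, `sum_conjPi_conjPi_pow`, `map_sum_conjPi` bookkeeping and the PRODUCT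
  DECOMPOSITION `sum_range_mul_conjPi_pow` (`Σ_{i<ab} conj_{γ^{mi}} = Σ_{i<a} conj_{γ^{mi}} ∘ Σ_{j<b} conj_{γ^{maj}}`).
* §3 `resPi_proj_eq_sum_conjPi_proj`: `res_{k→k+n} (proj_k s) = Σ_{i<pⁿ} conj_{γ^{p^k i}} (proj_{k+n} s)` for
  `s ∈ 𝔖` (`LambdaAdicSelmerData`), by induction from `proj_norm`.
* §4 `resPi_layer_injective_of_noPTorsion`: `res : ∏ H¹(K_k, E[p^m]) → ∏ H¹(K_ℓ, E[p^m])` (`ℓ ≥ k`) is injective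
  when `E(K)[p] = 0` (tree: `resOfLe_injective_of_forall_fixed_eq_zero`, `fixedPoints_kerSubgroup_geomPrimaryTorsion_eq_bot`).
* §5 `sum_conjPi_eq_pow_smul_of_isKummerFamilyOver`: for `P` fixed by `Gal(K̄/K_k)` and its Kummer family `d`
  over `K_ℓ`, `Σ_{i<pⁿ} conj_{γ^{p^k i}} d = pⁿ • d`.
HONEST FRAMING: bookkeeping only; nothing about any particular curve; BSD is not proved by any of this.

References: [PerrinRiou1987BSMF] §0 pp. 401–402 (`S_p(L)`, `𝔖_p(L)`, corestriction/restriction, `res ∘ cor = N`);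
[GreenbergLNM1716] §3 Lemma 3.1 (kernel of restriction in a `ℤ_p`-tower); [Washington1997] §13.2
(`ω_n`, `ℤ_p[Γ/Γ_n]`); [Howard2004HeegnerKolyvagin] §1 (compact Kummer map), §3.3.
-/

set_option autoImplicit false

noncomputable section

open scoped Classical

open WeierstrassCurve Literature.NumberTheory.EllipticCurves PowerSeries

universe u

/-! ## §1 Operator algebra on `∏_m H¹(H, E[p^m])` -/

namespace WeierstrassCurve

section Operators

variable {K : Type u} [Field K] (V : WeierstrassCurve K) (p : ℕ)
  (H : Subgroup (Field.absoluteGaloisGroup K))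

/-- Levelwise, a natural number acts on `H¹(H, E[p^k])` through its residue mod `p^k` (the group is killed by
`p^k`, `pow_smul_torsionH1Over_eq_zero`). [cite: PerrinRiou1987BSMF, §0 p. 401 (S(L)^{(p^k)} is p^k-torsion)] -/
theorem natCast_mod_pow_zsmul_torsionH1Over [Fact p.Prime] (k x : ℕ) (y : V.torsionH1Over ((p : ℤ) ^ k) H) :
    (((x % p ^ k : ℕ) : ℤ)) • y = ((x : ℕ) : ℤ) • y := by
  have hk : (((p ^ k : ℕ) : ℤ)) • y = 0 := by
    rw [Nat.cast_pow]
    exact V.pow_smul_torsionH1Over_eq_zero H p k y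
  conv_rhs => rw [← Nat.mod_add_div x (p ^ k)]
  rw [Nat.cast_add, add_zsmul, Nat.cast_mul, mul_comm, mul_zsmul, hk, zsmul_zero, add_zero]

/-- **`(a + b) · y = a · y + b · y`** for the `ℤ_p`-action `padicPi` (levelwise: residues add modulo `p^k`,
which kills the level). [cite: PerrinRiou1987BSMF, §0 p. 401 (the ℤ_p-module structure of S_p(L))] -/
theorem padicPi_add_left [Fact p.Prime] (a b : ℤ_[p]) (y : V.torsionH1Pi p H) :
    V.padicPi p H (a + b) y = V.padicPi p H a y + V.padicPi p H b y := by
  funext k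
  haveI : NeZero (p ^ k) := ⟨pow_ne_zero _ (Fact.out : p.Prime).ne_zero⟩
  rw [Pi.add_apply, padicPi_apply, padicPi_apply, padicPi_apply, map_add, ZMod.val_add,
    V.natCast_mod_pow_zsmul_torsionH1Over p H, Nat.cast_add, add_zsmul]

/-- `0 · y = 0` for `padicPi`. [cite: PerrinRiou1987BSMF, §0 p. 401 (the ℤ_p-module structure of S_p(L))] -/
theorem padicPi_zero_left [Fact p.Prime] (y : V.torsionH1Pi p H) : V.padicPi p H 0 y = 0 := by
  funext k
  rw [padicPi_apply, map_zero, ZMod.val_zero, Nat.cast_zero, zero_zsmul, Pi.zero_apply]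

/-- `(a − b) · y = a · y − b · y` for `padicPi`. [cite: PerrinRiou1987BSMF, §0 p. 401 (the ℤ_p-module structure of S_p(L))] -/
theorem padicPi_sub_left [Fact p.Prime] (a b : ℤ_[p]) (y : V.torsionH1Pi p H) :
    V.padicPi p H (a - b) y = V.padicPi p H a y - V.padicPi p H b y := by
  rw [eq_sub_iff_add_eq, ← padicPi_add_left, sub_add_cancel]

/-- `(−a) · y = −(a · y)` for `padicPi`. [cite: PerrinRiou1987BSMF, §0 p. 401 (the ℤ_p-module structure of S_p(L))] -/
theorem padicPi_neg_left [Fact p.Prime] (a : ℤ_[p]) (y : V.torsionH1Pi p H) :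
    V.padicPi p H (-a) y = -V.padicPi p H a y := by
  rw [← zero_sub, padicPi_sub_left, padicPi_zero_left, zero_sub]

/-- A unit of `ℤ_p` times its `Ring.inverse` acts trivially: `a · (a⁻¹ · y) = y`.
[cite: PerrinRiou1987BSMF, §0 p. 401 (the ℤ_p-module structure of S_p(L))] -/
theorem padicPi_mul_ringInverse [Fact p.Prime] {a : ℤ_[p]} (ha : IsUnit a) (y : V.torsionH1Pi p H) :
    V.padicPi p H a (V.padicPi p H (Ring.inverse a) y) = y := by
  rw [padicPi_padicPi, Ring.mul_inverse_cancel _ ha, padicPi_one]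

/-- `a⁻¹ · (a · y) = y` for a unit `a` of `ℤ_p`. [cite: PerrinRiou1987BSMF, §0 p. 401 (the ℤ_p-module structure of S_p(L))] -/
theorem padicPi_ringInverse_mul [Fact p.Prime] {a : ℤ_[p]} (ha : IsUnit a) (y : V.torsionH1Pi p H) :
    V.padicPi p H (Ring.inverse a) (V.padicPi p H a y) = y := by
  rw [padicPi_padicPi, Ring.inverse_mul_cancel _ ha, padicPi_one]

/-- Restriction commutes with the `ℤ_p`-action (both act componentwise; `res` is additive).
[cite: PerrinRiou1987BSMF, §0 pp. 401–402 (restriction S_p(K_n) → S_p(K_{n+1}) is ℤ_p-linear)] -/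
theorem resPi_padicPi [Fact p.Prime] {H' : Subgroup (Field.absoluteGaloisGroup K)} (h : H ≤ H') (c : ℤ_[p])
    (y : V.torsionH1Pi p H') : V.resPi p h (V.padicPi p H' c y) = V.padicPi p H c (V.resPi p h y) := by
  funext k
  simp only [resPi, padicPi, AddMonoidHom.pi_apply, AddMonoidHom.coe_comp, Function.comp_apply,
    Pi.evalAddMonoidHom_apply, zsmulAddGroupHom_apply, map_zsmul]

/-- Restriction commutes with conjugation (`resOfLe_comp_conjH1_holds` componentwise).
[cite: NeukirchSchmidtWingberg2008, I.§5 (res ∘ conj = conj ∘ res)] -/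
theorem resPi_conjPi {H' : Subgroup (Field.absoluteGaloisGroup K)} [H.Normal] [H'.Normal] (h : H ≤ H')
    (σ : Field.absoluteGaloisGroup K) (y : V.torsionH1Pi p H') :
    V.resPi p h (V.conjPi p H' σ y) = V.conjPi p H σ (V.resPi p h y) := by
  funext k
  simp only [resPi, conjPi, AddMonoidHom.pi_apply, AddMonoidHom.coe_comp, Function.comp_apply,
    Pi.evalAddMonoidHom_apply]
  rw [← AddMonoidHom.comp_apply,
    Literature.NumberTheory.EllipticCurves.resOfLe_comp_conjH1_holds (M := geomTorsion V ((p : ℤ) ^ k)) h σ,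
    AddMonoidHom.comp_apply]

/-- Transitivity of restriction on `∏_m H¹(·, E[p^m])` (`resOfLe_comp_holds` componentwise).
[cite: NeukirchSchmidtWingberg2008, I.§5 (transitivity of restriction)] -/
theorem resPi_resPi {H' H'' : Subgroup (Field.absoluteGaloisGroup K)} (h : H ≤ H') (h' : H' ≤ H'')
    (y : V.torsionH1Pi p H'') : V.resPi p h (V.resPi p h' y) = V.resPi p (h.trans h') y := by
  funext k
  simp only [resPi, AddMonoidHom.pi_apply, AddMonoidHom.coe_comp, Function.comp_apply,
    Pi.evalAddMonoidHom_apply]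
  rw [← AddMonoidHom.comp_apply,
    Literature.NumberTheory.EllipticCurves.resOfLe_comp_holds (M := geomTorsion V ((p : ℤ) ^ k)) h h']

/-- Inner automorphisms act trivially: `conj_σ = id` on `∏_m H¹(H, E[p^m])` for `σ ∈ H`
(`conjH1_of_mem_holds` componentwise). [cite: SerreLocalFields1979, VII.§5 Prop. 3] -/
theorem conjPi_eq_self_of_mem [H.Normal] {σ : Field.absoluteGaloisGroup K} (hσ : σ ∈ H)
    (y : V.torsionH1Pi p H) : V.conjPi p H σ y = y := by
  funext k
  simp only [conjPi, AddMonoidHom.pi_apply, AddMonoidHom.coe_comp, Function.comp_apply,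
    Pi.evalAddMonoidHom_apply]
  rw [Literature.NumberTheory.EllipticCurves.conjH1_of_mem_holds H (geomTorsion V ((p : ℤ) ^ k)) hσ, AddMonoidHom.id_apply]

/-- `conj_{στ} y = conj_σ (conj_τ y)`, with `τ ∈ H` acting trivially: `conj_{στ} = conj_σ` for `τ ∈ H`.
[cite: SerreLocalFields1979, VII.§5 Prop. 3] -/
theorem conjPi_mul_eq_of_mem [H.Normal] (σ : Field.absoluteGaloisGroup K) {τ : Field.absoluteGaloisGroup K}
    (hτ : τ ∈ H) (y : V.torsionH1Pi p H) : V.conjPi p H (σ * τ) y = V.conjPi p H σ y := by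
  rw [conjPi_mul, conjPi_eq_self_of_mem V p H hτ]

end Operators

section Tower

variable {K : Type u} [Field K] [NumberField K] (V : WeierstrassCurve K) (p : ℕ) [Fact p.Prime]
  (κ : ZpExtension K p) {γ : Field.absoluteGaloisGroup K}

omit [NumberField K] in
/-- `γ^{p^k i} ∈ Gal(K̄/K_k)` for a topological generator `γ`.
[cite: Washington1997, §13.2 (Γ_n = Γ^{p^n})] -/
theorem zpExtension_pow_pow_mul_mem_layerSubgroup (hγ : κ.IsTopGenerator γ) (k i : ℕ) :
    γ ^ (p ^ k * i) ∈ κ.layerSubgroup k := by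
  rw [pow_mul]
  exact Subgroup.pow_mem _ (LambdaAdicSelmerDataExists.pow_mem_layerSubgroup p κ hγ k) i

omit [NumberField K] in
/-- On level `k`, `conj_{γ^i}` depends only on `i mod p^k` (`γ^{p^k} ∈ Gal(K̄/K_k)` acts trivially).
[cite: Washington1997, §13.2 (Λ/ω_n ≅ ℤ_p[Γ/Γ_n])] -/
theorem conjPi_pow_eq_conjPi_pow_mod (hγ : κ.IsTopGenerator γ) (k i : ℕ)
    (y : V.torsionH1Pi p (κ.layerSubgroup k)) :
    V.conjPi p (κ.layerSubgroup k) (γ ^ i) y = V.conjPi p (κ.layerSubgroup k) (γ ^ (i % p ^ k)) y := by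
  conv_lhs => rw [← Nat.mod_add_div i (p ^ k), pow_add]
  exact conjPi_mul_eq_of_mem V p _ _ (zpExtension_pow_pow_mul_mem_layerSubgroup p κ hγ k _) y

end Tower

/-! ## §2 Sums of conjugations (norm operators) -/

section NormSums

variable {K : Type u} [Field K] (V : WeierstrassCurve K) (p : ℕ) [Fact p.Prime]
  (H : Subgroup (Field.absoluteGaloisGroup K)) [H.Normal]

/-- A sum of conjugations commutes with the `ℤ_p`-action. [cite: PerrinRiou1987BSMF, §0 pp. 401–402 (ℤ_p[Gal]-module structure)] -/
theorem sum_conjPi_padicPi (s : Finset ℕ) (g : ℕ → Field.absoluteGaloisGroup K) (c : ℤ_[p])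
    (y : V.torsionH1Pi p H) :
    ∑ i ∈ s, V.conjPi p H (g i) (V.padicPi p H c y) = V.padicPi p H c (∑ i ∈ s, V.conjPi p H (g i) y) := by
  rw [map_sum]
  exact Finset.sum_congr rfl fun i _ ↦ conjPi_padicPi_comm V p H (g i) c y

omit [Fact p.Prime] in
/-- A sum of conjugations by powers of `γ` commutes with `conj_{γ^b}`. [cite: PerrinRiou1987BSMF, §0 pp. 401–402 (ℤ_p[Gal]-module structure)] -/
theorem sum_conjPi_pow_conjPi_pow (γ : Field.absoluteGaloisGroup K) (s : Finset ℕ) (a : ℕ → ℕ) (b : ℕ)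
    (y : V.torsionH1Pi p H) :
    ∑ i ∈ s, V.conjPi p H (γ ^ a i) (V.conjPi p H (γ ^ b) y) =
      V.conjPi p H (γ ^ b) (∑ i ∈ s, V.conjPi p H (γ ^ a i) y) := by
  rw [map_sum]
  refine Finset.sum_congr rfl fun i _ ↦ ?_
  rw [← conjPi_mul, ← conjPi_mul, ← pow_add, ← pow_add, add_comm]

omit [Fact p.Prime] in
/-- A sum of conjugations is additive in its argument. [cite: PerrinRiou1987BSMF, §0 pp. 401–402] -/
theorem sum_conjPi_add (s : Finset ℕ) (g : ℕ → Field.absoluteGaloisGroup K) (y y' : V.torsionH1Pi p H) :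
    ∑ i ∈ s, V.conjPi p H (g i) (y + y') = ∑ i ∈ s, V.conjPi p H (g i) y + ∑ i ∈ s, V.conjPi p H (g i) y' := by
  rw [← Finset.sum_add_distrib]
  exact Finset.sum_congr rfl fun i _ ↦ map_add _ _ _

omit [Fact p.Prime] in
/-- A sum of conjugations commutes with subtraction. [cite: PerrinRiou1987BSMF, §0 pp. 401–402] -/
theorem sum_conjPi_sub (s : Finset ℕ) (g : ℕ → Field.absoluteGaloisGroup K) (y y' : V.torsionH1Pi p H) :
    ∑ i ∈ s, V.conjPi p H (g i) (y - y') = ∑ i ∈ s, V.conjPi p H (g i) y - ∑ i ∈ s, V.conjPi p H (g i) y' := by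
  rw [← Finset.sum_sub_distrib]
  exact Finset.sum_congr rfl fun i _ ↦ map_sub _ _ _

omit [Fact p.Prime] in
/-- A sum of conjugations commutes with integer multiples. [cite: PerrinRiou1987BSMF, §0 pp. 401–402] -/
theorem sum_conjPi_zsmul (s : Finset ℕ) (g : ℕ → Field.absoluteGaloisGroup K) (n : ℤ) (y : V.torsionH1Pi p H) :
    ∑ i ∈ s, V.conjPi p H (g i) (n • y) = n • ∑ i ∈ s, V.conjPi p H (g i) y := by
  have h : ∀ i ∈ s, V.conjPi p H (g i) (n • y) = zsmulAddGroupHom n (V.conjPi p H (g i) y) :=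
    fun i _ ↦ map_zsmul _ _ _
  rw [Finset.sum_congr rfl h, ← map_sum]
  rfl

omit [Fact p.Prime] [H.Normal] in
/-- Restriction commutes with a sum of conjugations. [cite: NeukirchSchmidtWingberg2008, I.§5 (res ∘ conj = conj ∘ res)] -/
theorem resPi_sum_conjPi {H' : Subgroup (Field.absoluteGaloisGroup K)} [H.Normal] [H'.Normal] (h : H ≤ H')
    (s : Finset ℕ) (g : ℕ → Field.absoluteGaloisGroup K) (y : V.torsionH1Pi p H') :
    V.resPi p h (∑ i ∈ s, V.conjPi p H' (g i) y) = ∑ i ∈ s, V.conjPi p H (g i) (V.resPi p h y) := by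
  rw [map_sum]
  exact Finset.sum_congr rfl fun i _ ↦ resPi_conjPi V p H h (g i) y

omit [Fact p.Prime] in
/-- **Product decomposition of the norm sums**: for `a b m`,
`Σ_{i<ab} conj_{γ^{mi}} y = Σ_{i<a} conj_{γ^{mi}} (Σ_{j<b} conj_{γ^{maj}} y)` (write `i = i₁ + a j`). This is the
multiplicativity `N_{K_{k+n+1}/K_k} = N_{K_{k+n}/K_k} ∘ N_{K_{k+n+1}/K_{k+n}}` of the norm elements of `ℤ[Γ]`.
[cite: PerrinRiou1987BSMF, §0 pp. 401–402 (corestriction along the layers)] -/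
theorem sum_range_mul_conjPi_pow (γ : Field.absoluteGaloisGroup K) (a b m : ℕ) (y : V.torsionH1Pi p H) :
    ∑ i ∈ Finset.range (a * b), V.conjPi p H (γ ^ (m * i)) y =
      ∑ i ∈ Finset.range a, V.conjPi p H (γ ^ (m * i)) (∑ j ∈ Finset.range b, V.conjPi p H (γ ^ (m * a * j)) y) := by
  -- reindex `Σ_{i<ab} f i = Σ_{j<b} Σ_{i<a} f (i + a j)`
  have hre : ∀ (f : ℕ → V.torsionH1Pi p H),
      ∑ i ∈ Finset.range (a * b), f i = ∑ j ∈ Finset.range b, ∑ i ∈ Finset.range a, f (i + a * j) := by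
    intro f
    induction b with
    | zero => simp
    | succ b ih =>
      rw [Finset.sum_range_succ, ← ih, Nat.mul_succ, Finset.sum_range_add]
      congr 1
      exact Finset.sum_congr rfl fun i _ ↦ by rw [add_comm]
  rw [hre, Finset.sum_comm]
  refine Finset.sum_congr rfl fun i _ ↦ ?_
  rw [map_sum]
  refine Finset.sum_congr rfl fun j _ ↦ ?_
  have hexp : m * (i + a * j) = m * i + m * a * j := by ring
  rw [← conjPi_mul, ← pow_add, hexp]

end NormSums

end WeierstrassCurve

/-! ## §3 The iterated norm compatibility of `𝔖_p(K_∞)` -/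

namespace WeierstrassCurve.LambdaAdicSelmerData

variable {K : Type u} [Field K] [NumberField K] {V : WeierstrassCurve K} {p : ℕ} [Fact p.Prime]
  {κ : ZpExtension K p} {γ : Field.absoluteGaloisGroup K} (D : V.LambdaAdicSelmerData κ γ)

/-- **Universal norms**: for `s ∈ 𝔖_p(K_∞)` and layers `k ≤ k + n`,
`res_{K_k}^{K_{k+n}} (proj_k s) = Σ_{i<pⁿ} conj_{γ^{p^k i}} (proj_{k+n} s) = N_{K_{k+n}/K_k} (proj_{k+n} s)`
(the `n`-fold iterate of `proj_norm`: `Gal(K_{k+n}/K_k) = {γ^{p^k i}}_{i<pⁿ}`).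
[cite: PerrinRiou1987BSMF, §0 p. 402 (𝔖_p(L) = lim← S_p(F′) along corestriction; res ∘ cor = N)] -/
theorem resPi_proj_eq_sum_conjPi_proj (k n : ℕ) (s : D.S) :
    V.resPi p (κ.layerSubgroup_antitone (Nat.le_add_right k n)) (D.proj k s) =
      ∑ i ∈ Finset.range (p ^ n), V.conjPi p (κ.layerSubgroup (k + n)) (γ ^ (p ^ k * i)) (D.proj (k + n) s) := by
  induction n with
  | zero =>
    show V.resPi p (le_refl (κ.layerSubgroup k)) (D.proj k s) =
      ∑ i ∈ Finset.range (p ^ 0), V.conjPi p (κ.layerSubgroup k) (γ ^ (p ^ k * i)) (D.proj k s)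
    rw [pow_zero, Finset.sum_range_one, mul_zero, pow_zero]
    funext m
    simp only [resPi, conjPi, AddMonoidHom.pi_apply, AddMonoidHom.coe_comp, Function.comp_apply,
      Pi.evalAddMonoidHom_apply]
    rw [Literature.NumberTheory.EllipticCurves.conjH1_one_holds, AddMonoidHom.id_apply,
      Literature.NumberTheory.EllipticCurves.resOfLe_refl_holds, AddMonoidHom.id_apply]
  | succ n ih =>
    show V.resPi p (κ.layerSubgroup_antitone (Nat.le_add_right k (n + 1))) (D.proj k s) =
      ∑ i ∈ Finset.range (p ^ (n + 1)), V.conjPi p (κ.layerSubgroup (k + n + 1)) (γ ^ (p ^ k * i))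
        (D.proj (k + n + 1) s)
    have hstep : κ.layerSubgroup (k + n + 1) ≤ κ.layerSubgroup (k + n) := κ.layerSubgroup_antitone (Nat.le_succ _)
    rw [← V.resPi_resPi p _ hstep (κ.layerSubgroup_antitone (Nat.le_add_right k n)), ih,
      V.resPi_sum_conjPi p _ hstep, D.proj_norm (k + n) s, pow_succ p n,
      V.sum_range_mul_conjPi_pow p _ γ (p ^ n) p (p ^ k)]
    refine Finset.sum_congr rfl fun i _ ↦ ?_
    congr 1
    refine Finset.sum_congr rfl fun j _ ↦ ?_
    rw [← pow_add]

end WeierstrassCurve.LambdaAdicSelmerData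

/-! ## §4 Restriction along the tower is injective under `E(K)[p] = 0` -/

namespace WeierstrassCurve

variable {K : Type u} [Field K] [NumberField K] (V : WeierstrassCurve K) [V.IsElliptic] (p : ℕ) [Fact p.Prime]
  (κ : ZpExtension K p)

/-- **`res : ∏_m H¹(K_k, E[p^m]) → ∏_m H¹(K_ℓ, E[p^m])` is injective** for layers `K_k ⊆ K_ℓ` of a
`ℤ_p`-extension when `E(K)[p] = 0`: componentwise inflation–restriction
(`resOfLe_injective_of_forall_fixed_eq_zero`), the kernel living on `E[p^m]^{Gal(K̄/K_ℓ)} ⊆ E(K_∞)[p^∞] = 0`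
(`fixedPoints_kerSubgroup_geomPrimaryTorsion_eq_bot`). [cite: GreenbergLNM1716, §3 Lemma 3.1 (ker h_n ≅ H¹(Γ_n, E(F_∞)[p^∞])) and §4 p. 109 (E(F_∞)[p^∞] = 0 when E(F)[p] = 0)] -/
theorem resPi_layer_injective_of_noPTorsion (hE : ∀ P : V.toAffine.Point, p • P = 0 → P = 0) {k ℓ : ℕ}
    (h : κ.layerSubgroup ℓ ≤ κ.layerSubgroup k) : Function.Injective (V.resPi p h) := by
  have hbot := V.fixedPoints_kerSubgroup_geomPrimaryTorsion_eq_bot κ hE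
  have hfix : ∀ (m : ℕ) (x : geomTorsion V ((p : ℤ) ^ m)),
      (∀ σ ∈ κ.layerSubgroup ℓ, σ • x = x) → x = 0 := by
    intro m x hx
    have hmem : (x : geomPoints V) ∈ geomPrimaryTorsion V p := by
      refine (AddCommGroup.mem_primaryComponent).mpr ⟨m, ?_⟩
      have := (mem_geomTorsion_iff V _ _).mp x.2
      rwa [← natCast_zsmul, Nat.cast_pow]
    have hx' : (⟨(x : geomPoints V), hmem⟩ : geomPrimaryTorsion V p) ∈
        FixedPoints.addSubgroup κ.kerSubgroup (geomPrimaryTorsion V p) := by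
      rw [FixedPoints.mem_addSubgroup]
      rintro ⟨τ, hτ⟩
      apply Subtype.ext
      rw [Subgroup.mk_smul, primaryComponent.coe_smul]
      have := hx τ (κ.kerSubgroup_le_layerSubgroup ℓ hτ)
      rw [← AddSubgroup.torsionBy.coe_smul, this]
    rw [hbot, AddSubgroup.mem_bot] at hx'
    have hx0 : (x : geomPoints V) = 0 := congrArg Subtype.val hx'
    exact Subtype.ext hx0
  intro y y' hyy'
  funext m
  have hm := congrFun hyy' m
  simp only [resPi, AddMonoidHom.pi_apply, AddMonoidHom.coe_comp, Function.comp_apply,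
    Pi.evalAddMonoidHom_apply] at hm
  exact resOfLe_injective_of_forall_fixed_eq_zero (M := geomTorsion V ((p : ℤ) ^ m)) h (hfix m) hm

end WeierstrassCurve

/-! ## §5 Norms of Kummer families of points rational over a lower layer -/

namespace WeierstrassCurve

variable {K : Type u} [Field K] [NumberField K] (V : WeierstrassCurve K) [V.IsElliptic] (p : ℕ) [Fact p.Prime]
  (κ : ZpExtension K p) {γ : Field.absoluteGaloisGroup K}

omit [NumberField K] in
/-- **The norm of the Kummer family of a `K_k`-rational point is a `pⁿ`-multiple**: if `P` is fixed by
`Gal(K̄/K_k)` and `d` is its Kummer family over `K_ℓ` (`Gal(K̄/K_ℓ) ≤ Gal(K̄/K_k)`), then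
`Σ_{i<pⁿ} conj_{γ^{p^k i}} d = pⁿ • d` (each `conj_{γ^{p^k i}} d` is the Kummer family of `γ^{p^k i} • P = P`).
[cite: Howard2004HeegnerKolyvagin, §1 (the compact Kummer map is Gal-equivariant)] -/
theorem sum_conjPi_eq_pow_smul_of_isKummerFamilyOver (hγ : κ.IsTopGenerator γ) {k ℓ n : ℕ}
    (hkℓ : κ.layerSubgroup ℓ ≤ κ.layerSubgroup k) {P : geomPoints V} (hP : ∀ σ ∈ κ.layerSubgroup k, σ • P = P)
    {d : V.torsionH1Pi p (κ.layerSubgroup ℓ)}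
    (hd : V.IsKummerFamilyOver p (κ.layerSubgroup ℓ) (fun σ hσ ↦ hP σ (hkℓ hσ)) d) :
    ∑ i ∈ Finset.range (p ^ n), V.conjPi p (κ.layerSubgroup ℓ) (γ ^ (p ^ k * i)) d = ((p : ℤ) ^ n) • d := by
  have hconj : ∀ i, V.conjPi p (κ.layerSubgroup ℓ) (γ ^ (p ^ k * i)) d = d := fun i ↦ by
    have h1 := hd.conjPi (γ ^ (p ^ k * i))
    have heq : γ ^ (p ^ k * i) • P = P := hP _ (zpExtension_pow_pow_mul_mem_layerSubgroup p κ hγ k i)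
    exact IsKummerFamilyOver.unique p (IsKummerFamilyOver.of_eq heq h1) hd
  rw [Finset.sum_congr rfl fun i _ ↦ hconj i, Finset.sum_const, Finset.card_range, ← natCast_zsmul,
    Nat.cast_pow]

omit [NumberField K] in
/-- **A Kummer family over `K_ℓ` of a `K_k`-rational point is the restriction of its Kummer family over
`K_k`** (`IsKummerFamilyOver.resPi` + uniqueness). [cite: PerrinRiou1987BSMF, §0 pp. 401–402 (restriction S_p(K_n) → S_p(K_{n+1}))] -/
theorem eq_resPi_of_isKummerFamilyOver {k ℓ : ℕ} (hkℓ : κ.layerSubgroup ℓ ≤ κ.layerSubgroup k)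
    {P : geomPoints V} (hP : ∀ σ ∈ κ.layerSubgroup k, σ • P = P) {dk : V.torsionH1Pi p (κ.layerSubgroup k)}
    (hdk : V.IsKummerFamilyOver p (κ.layerSubgroup k) hP dk) {dℓ : V.torsionH1Pi p (κ.layerSubgroup ℓ)}
    (hdℓ : V.IsKummerFamilyOver p (κ.layerSubgroup ℓ) (fun σ hσ ↦ hP σ (hkℓ hσ)) dℓ) :
    dℓ = V.resPi p hkℓ dk :=
  IsKummerFamilyOver.unique p hdℓ (hdk.resPi hkℓ)

end WeierstrassCurve

end
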